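import Summits.CriticalPhenomena.CardyFormulaZ2.Theorems.CardyBondTriangularBondTriangularCardyBlueArmCycleEnd
import HarnessLib

/-!
# Route CardyBondTriangular · crux `BondTriangularCardy` · line `birth`: the blue arm of Claim 10 — the cycle case is impossible

Helper of the stub `stub_blueArm`; port of `TriClaim10Cycle.cyc_false` to the kite walk
(Bollobás–Riordan, *Percolation* (2006), Ch. 7, pp. 178–179). If the kite interface from the edge
`f` at `w` (left kite a blue kite of a hexagon of `w` at the corner `w`, right kite a kite of
`x₂`, predecessor with a kite of `x₁` on its right) came back to `f`, its right cells
`ρ₀ = x₂, …, ρ_{N-1} = x₁` would provide a yellow path separating `w` from `A₀`: with `r` the last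
index whose right cell is on the final part of the path or a contact with `A₂`, and `s ≥ r` the
first index after it whose right cell is on the initial part or a contact with `A₁` — the right
cells strictly between being hexagons of `G` (`cyc_block_exit_two`) off the path —, `r < s` is the
main case (`cyc_main_false`), `r = s` the degenerate contacts (`false_of_contact_one/two`,
`false_of_two_sided`).

## References

* B. Bollobás, O. Riordan, *Percolation*, CUP (2006), Ch. 7, Claim 10 pp. 178–179.
-/

namespace Summit.CriticalPhenomena.CardyFormulaZ2.Theorems.BondTriangularCardyLine.KiteB

open Finset Literature.Probability.Percolation Literature.Probability.LatticeModels

/-- **The first site of a list split as `A ++ B`, `A ≠ []`, lies in `A`** (registered anchor of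
this file). -/
theorem head_mem_of_eq_append : ∀ {A B l : List (Literature.Probability.LatticeModels.Site 2)} (hA : A ≠ []) (hl : l ≠ []), l = A ++ B → l.head hl ∈ A := by
  intro A B l hA hl h
  rw [← head_eq_of_eq_append hA hl h]; exact List.head_mem hA

/-- The last site of a list split as `A ++ B`, `B ≠ []`, lies in `B`. -/
theorem getLast_mem_of_eq_append {A B l : List (Site 2)} (hB : B ≠ []) (hl : l ≠ []) (h : l = A ++ B) : l.getLast hl ∈ B := by
  rw [← getLast_eq_of_eq_append hB hl h]; exact List.getLast_mem hB

section CycleFalse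

variable (D : TriMarkedDomain 3) {σ : CLHexConfig} {w : HexVertex} {orb : ℕ → KDart} {N : ℕ}
  (horb : ∀ k < N, succ (kcol D σ) (orb k) = orb (k + 1))
  (hiface : ∀ k < N, iface (kcol D σ) (orb k) = true) (hadm : ∀ k < N, (orb k).adm = true)
  (hleft : ∀ k < N, (orb k).leftCell ∈ D.verts) (hretG : (orb N).leftCell ∈ D.verts) (hbc0 : (orb 0).leftCorner = w)
  (hnotw : ∀ (Q' : List (Site 2)) (hne : Q' ≠ []), Q'.Nodup → List.IsChain triGraph.Adj Q' →
    (∀ s ∈ Q', s ∈ D.verts ∧ σ s ≠ CLHexState.B) → (∀ d ∈ pathDarts Q', (clYellowGraph σ).Adj d.1 d.2) →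
    ∀ nu' nv' : ℕ, D.pos 1 ≤ nu' → nu' < D.pos 2 → D.pos 2 ≤ nv' → nv' < #(triBdryDarts D.verts) →
    Q'.head hne = (triBdryIter D.verts D.base nu').1 → YellowTowards σ (triBdryIter D.verts D.base nu') →
    Q'.getLast hne = (triBdryIter D.verts D.base nv').1 → YellowTowards σ (triBdryIter D.verts D.base nv') →
    ¬ Separates D.verts {e : Sym2 (Site 2) | ∃ d ∈ pathDarts Q', e = s(d.1, d.2)} w (D.stretch 0))

include horb hiface hadm hleft in
/-- **A contact dart is yellow towards its head**: consecutive distinct right cells are yellow at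
a common corner, so a right cell of `G` followed (or preceded) by an outer one shows yellow on the
boundary edge between them. -/
theorem cyc_yellowTowards {k : ℕ} (hk : k + 1 < N) :
    ((orb k).rightCell ∈ D.verts → (orb (k + 1)).rightCell ∉ D.verts →
        YellowTowards σ ((orb k).rightCell, (orb (k + 1)).rightCell)) ∧
      ((orb (k + 1)).rightCell ∈ D.verts → (orb k).rightCell ∉ D.verts →
        YellowTowards σ ((orb (k + 1)).rightCell, (orb k).rightCell)) := by
  constructor
  · intro hin hout
    rcases cyc_rightCell_succ D horb hiface hadm hleft hk with h | ⟨-, G, m1, m2, c1, -⟩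
    · exact absurd (h ▸ hin) hout
    · rw [ccol_of_mem hin m1, decide_eq_true_eq] at c1
      exact ⟨G, m1, m2, c1⟩
  · intro hin hout
    rcases cyc_rightCell_succ D horb hiface hadm hleft hk with h | ⟨-, G, m1, m2, -, c2⟩
    · exact absurd (h.symm ▸ hin) hout
    · rw [ccol_of_mem hin m2, decide_eq_true_eq] at c2
      exact ⟨G, m2, m1, c2⟩

include horb hiface hadm hleft hretG hbc0 hnotw in
/-- **The kite interface from `w` does not close up** (`TriClaim10Cycle.cyc_false` for the
Chayes–Lei model). -/
theorem cyc_false {Q L₁ L₂ : List (Site 2)} {a b : Site 2} (hQeq : Q = L₁ ++ a :: b :: L₂) (hQnd : Q.Nodup)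
    (hQch : List.IsChain triGraph.Adj Q) (hQG : ∀ s ∈ Q, s ∈ D.verts) (hQB : ∀ s ∈ Q, σ s ≠ CLHexState.B)
    (hQY : ∀ d ∈ pathDarts Q, (clYellowGraph σ).Adj d.1 d.2)
    {nu nv : ℕ} (hnu1 : D.pos 1 ≤ nu) (hnu2 : nu < D.pos 2) (hnv2 : D.pos 2 ≤ nv) (hnvL : nv < #(triBdryDarts D.verts))
    (hQhead : Q.head (by rw [hQeq]; simp) = (triBdryIter D.verts D.base nu).1)
    (hYu : YellowTowards σ (triBdryIter D.verts D.base nu))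
    (hQlast : Q.getLast (by rw [hQeq]; simp) = (triBdryIter D.verts D.base nv).1)
    (hYv : YellowTowards σ (triBdryIter D.verts D.base nv))
    (hC : IsTriLoop (D.chordLoop Q nv (nu + #(triBdryDarts D.verts) - nv)))
    (hπw : faceLabel (cycDarts (D.chordLoop Q nv (nu + #(triBdryDarts D.verts) - nv))) w =
      leftLabel (D.chordLoop Q nv (nu + #(triBdryDarts D.verts) - nv)))
    (hw : leftFace a b = w) (hN : 0 < N) (hρ0 : (orb 0).rightCell = b) (hρN : (orb (N - 1)).rightCell = a) : False := by
  -- adapted from `TriClaim10Cycle.cyc_false` (site version)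
  classical
  set L := #(triBdryDarts D.verts) with hL
  set ρ : ℕ → Site 2 := fun k => (orb k).rightCell with hρ
  have hQne : Q ≠ [] := by rw [hQeq]; simp
  have hQeq' : Q = (L₁ ++ [a]) ++ (b :: L₂) := by rw [hQeq]; simp
  have hlt : nu < nv := by omega
  have hdisj : ∀ x, x ∈ L₁ ++ [a] → x ∈ b :: L₂ → False := fun x h1 h2 =>
    (List.nodup_append.1 (hQeq' ▸ hQnd)).2.2 x h1 x h2 rfl
  have hheadQ : Q.head hQne ∈ L₁ ++ [a] := head_mem_of_eq_append (by simp) hQne hQeq'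
  have hlastQ : Q.getLast hQne ∈ b :: L₂ := getLast_mem_of_eq_append (by simp) hQne hQeq'
  have hneHead : ∀ x, x ∉ L₁ ++ [a] → x ≠ Q.head hQne := fun x hx e => hx (e ▸ hheadQ)
  have hneLast : ∀ x, x ∉ b :: L₂ → x ≠ Q.getLast hQne := fun x hx e => hx (e ▸ hlastQ)
  have hstretch1 : ∀ {d}, d ∈ triBdryDarts D.verts → D.stretchIdx₃ (D.dpos d) = 1 →
      D.pos 1 ≤ D.dpos d ∧ D.dpos d < D.pos 2 := by
    intro d hd hs
    have hlt' := D.dpos_lt hd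
    unfold TriMarkedDomain.stretchIdx₃ at hs
    rw [Nat.mod_eq_of_lt hlt'] at hs
    by_cases ha : D.dpos d < D.pos 1
    · rw [if_pos ha] at hs; exact absurd hs (by decide)
    · rw [if_neg ha] at hs
      by_cases hb : D.dpos d < D.pos 2
      · exact ⟨by omega, hb⟩
      · rw [if_neg hb] at hs; exact absurd hs (by decide)
  have hne0 : ∀ {i : Fin 3}, i ≠ 0 → i = 1 ∨ i = 2 := by decide
  -- anchors
  let A2 : ℕ → Prop := fun k => ρ k ∈ b :: L₂ ∨
    (ρ k ∈ D.verts ∧ 1 ≤ k ∧ ρ (k - 1) ∉ D.verts ∧ D.stretchIdx₃ (D.dpos (ρ k, ρ (k - 1))) = 2)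
  let A1 : ℕ → Prop := fun k => ρ k ∈ L₁ ++ [a] ∨
    (ρ k ∈ D.verts ∧ k + 1 < N ∧ ρ (k + 1) ∉ D.verts ∧ D.stretchIdx₃ (D.dpos (ρ k, ρ (k + 1))) = 1)
  have hA2G : ∀ k, A2 k → ρ k ∈ D.verts := fun k h => h.elim (fun h => hQG _ (by rw [hQeq']; exact List.mem_append_right _ h)) (fun h => h.1)
  have hA1G : ∀ k, A1 k → ρ k ∈ D.verts := fun k h => h.elim (fun h => hQG _ (by rw [hQeq']; exact List.mem_append_left _ h)) (fun h => h.1)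
  set r := Nat.findGreatest A2 (N - 1) with hrdef
  have hA2_0 : A2 0 := Or.inl (by show ρ 0 ∈ b :: L₂; rw [show ρ 0 = b from hρ0]; simp)
  have hA2r : A2 r := Nat.findGreatest_spec (P := A2) (Nat.zero_le _) hA2_0
  have hrN : r ≤ N - 1 := Nat.findGreatest_le _
  have hrmax : ∀ k, r < k → k ≤ N - 1 → ¬ A2 k := fun k h1 h2 => Nat.findGreatest_is_greatest h1 h2
  have hA1_N : A1 (N - 1) := Or.inl (by show ρ (N - 1) ∈ L₁ ++ [a]; rw [show ρ (N - 1) = a from hρN]; simp)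
  have hex1 : ∃ k, r ≤ k ∧ k ≤ N - 1 ∧ A1 k := ⟨N - 1, hrN, le_rfl, hA1_N⟩
  set s := Nat.find hex1 with hsdef
  obtain ⟨hrs, hsN, hA1s⟩ := Nat.find_spec hex1
  have hsmin : ∀ k, r ≤ k → k < s → ¬ A1 k := fun k h1 h2 h3 =>
    Nat.find_min hex1 (show k < Nat.find hex1 from h2) ⟨h1, by omega, h3⟩
  have hρrG : ρ r ∈ D.verts := hA2G r hA2r
  have hρsG : ρ s ∈ D.verts := hA1G s hA1s
  have hsN' : s < N := by omega
  -- contact darts: membership, positions, yellow half-edges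
  have hc1 : ∀ k, k + 1 < N → ρ k ∈ D.verts → ρ (k + 1) ∉ D.verts →
      D.stretchIdx₃ (D.dpos (ρ k, ρ (k + 1))) = 1 → ρ k ≠ Q.head hQne →
      (ρ k, ρ (k + 1)) ∈ triBdryDarts D.verts ∧ D.pos 1 ≤ D.dpos (ρ k, ρ (k + 1)) ∧
        D.dpos (ρ k, ρ (k + 1)) < nu ∧ (triBdryIter D.verts D.base (D.dpos (ρ k, ρ (k + 1)))).1 = ρ k ∧
        YellowTowards σ (triBdryIter D.verts D.base (D.dpos (ρ k, ρ (k + 1)))) := by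
    intro k hk hin hout hst hne
    obtain ⟨hd, hp1, hpu, ht⟩ := cyc_one_contact_pos D horb hiface hadm hleft hretG hbc0 hQne hQG hQY hnu1 hnu2 hnv2 hnvL hQhead
      hYu hQlast hYv hC hπw hk hin hout hst hne
    refine ⟨hd, hp1, hpu, ht, ?_⟩
    rw [D.iter_dpos hd]
    exact (cyc_yellowTowards D horb hiface hadm hleft hk).1 hin hout
  have hc2 : ∀ k, 1 ≤ k → k < N → ρ k ∈ D.verts → ρ (k - 1) ∉ D.verts →
      D.stretchIdx₃ (D.dpos (ρ k, ρ (k - 1))) = 2 → ρ k ≠ Q.getLast hQne →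
      (ρ k, ρ (k - 1)) ∈ triBdryDarts D.verts ∧ nv < D.dpos (ρ k, ρ (k - 1)) ∧
        D.dpos (ρ k, ρ (k - 1)) < L ∧ (triBdryIter D.verts D.base (D.dpos (ρ k, ρ (k - 1)))).1 = ρ k ∧
        YellowTowards σ (triBdryIter D.verts D.base (D.dpos (ρ k, ρ (k - 1)))) := by
    intro k hk1 hk hin hout hst hne
    have hk' : k - 1 + 1 < N := by omega
    have hin' : (orb (k - 1 + 1)).rightCell ∈ D.verts := by rw [show k - 1 + 1 = k by omega]; exact hin
    obtain ⟨hd, hpv, hpL, ht⟩ := cyc_two_contact_pos D horb hiface hadm hleft hretG hbc0 hQne hQG hQY hnu1 hnu2 hnv2 hnvL hQhead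
      hYu hQlast hYv hC hπw hk' hout hin' (by rw [show k - 1 + 1 = k by omega]; exact hst) (by rw [show k - 1 + 1 = k by omega]; exact hne)
    rw [show k - 1 + 1 = k by omega] at hd hpv hpL ht
    refine ⟨hd, hpv, hpL, ht, ?_⟩
    rw [D.iter_dpos hd]
    have := (cyc_yellowTowards D horb hiface hadm hleft hk').2 hin' hout
    rwa [show k - 1 + 1 = k by omega] at this
  -- a hexagon off the path cannot be both a contact with `A₁` and a contact with `A₂`
  have htwo : ∀ k₁ k₂, ρ k₁ = ρ k₂ → ρ k₁ ∉ Q →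
      (1 ≤ k₁ ∧ k₁ < N ∧ ρ k₁ ∈ D.verts ∧ ρ (k₁ - 1) ∉ D.verts ∧ D.stretchIdx₃ (D.dpos (ρ k₁, ρ (k₁ - 1))) = 2) →
      (k₂ + 1 < N ∧ ρ k₂ ∈ D.verts ∧ ρ (k₂ + 1) ∉ D.verts ∧ D.stretchIdx₃ (D.dpos (ρ k₂, ρ (k₂ + 1))) = 1) → False := by
    rintro k₁ k₂ heq hnQ ⟨h11, h12, h13, h14, h15⟩ ⟨h21, h22, h23, h24⟩
    have hu : (triBdryIter D.verts D.base nu).1 ∈ Q := by rw [← hQhead]; exact List.head_mem hQne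
    obtain ⟨-, hn'1, hn'u, ht', -⟩ := hc1 k₂ h21 h22 h23 h24 (fun e => hnQ (by rw [heq, e]; exact List.head_mem hQne))
    obtain ⟨-, hn''v, hn''L, ht'', -⟩ := hc2 k₁ h11 h12 h13 h14 h15 (fun e => hnQ (by rw [e]; exact List.getLast_mem hQne))
    refine D.false_of_two_sided hn'1 hn'u (show nu < D.dpos (ρ k₁, ρ (k₁ - 1)) by omega) hn''L ht' (by rw [ht'', heq]) ?_
    intro e
    exact hnQ (by rw [heq, ← e]; exact hu)
  -- (m1): the right cells strictly between are in `G`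
  have hm1 : ∀ k, r < k → k < s → ρ k ∈ D.verts := by
    intro k hk1 hk2
    by_contra hout
    have hexm : ∃ m, ∀ i, m ≤ i → i ≤ k → ρ i ∉ D.verts :=
      ⟨k, fun i h1 h2 => by rw [show i = k by omega]; exact hout⟩
    obtain ⟨hm₁k, hm₁⟩ : Nat.find hexm ≤ k ∧ ∀ i, Nat.find hexm ≤ i → i ≤ k → ρ i ∉ D.verts :=
      ⟨Nat.find_min' hexm (fun i h1 h2 => by rw [show i = k by omega]; exact hout), Nat.find_spec hexm⟩
    set m₁ := Nat.find hexm with hm₁def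
    have hm₁r : r < m₁ := by
      by_contra hle; push Not at hle
      exact hm₁ r hle (by omega) hρrG
    have hin₁ : ρ (m₁ - 1) ∈ D.verts := by
      by_contra h
      have : ∀ i, m₁ - 1 ≤ i → i ≤ k → ρ i ∉ D.verts := by
        intro i h1 h2
        by_cases hi : i = m₁ - 1
        · rw [hi]; exact h
        · exact hm₁ i (by omega) h2
      exact Nat.find_min hexm (show m₁ - 1 < Nat.find hexm by omega) this
    have hexj : ∃ j, 1 ≤ j ∧ ρ (k + j) ∈ D.verts :=
      ⟨s - k, by omega, by rw [show k + (s - k) = s by omega]; exact hρsG⟩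
    obtain ⟨hj₀1, hj₀G⟩ := Nat.find_spec hexj
    set j₀ := Nat.find hexj with hj₀def
    have hj₀le : j₀ ≤ s - k := Nat.find_min' hexj ⟨by omega, by rw [show k + (s - k) = s by omega]; exact hρsG⟩
    have houtj : ∀ j, 1 ≤ j → j < j₀ → ρ (k + j) ∉ D.verts := fun j h1 h2 hG =>
      Nat.find_min hexj (show j < Nat.find hexj from h2) ⟨h1, hG⟩
    -- entry dart
    have hm₁N : m₁ - 1 + 1 < N := by omega
    have hout₁ : (orb (m₁ - 1 + 1)).rightCell ∉ D.verts := by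
      rw [show m₁ - 1 + 1 = m₁ by omega]; exact hm₁ m₁ le_rfl hm₁k
    have hG₁ : (succ (kcol D σ) (orb (m₁ - 1))).leftCell ∈ D.verts := by rw [horb _ (by omega)]; exact hleft _ hm₁N
    obtain ⟨-, hst, -⟩ := trans_in_out (hiface _ (by omega)) (hadm _ (by omega)) (hleft _ (by omega)) hG₁ hin₁
      (by rw [horb _ (by omega)]; exact hout₁)
    rw [horb _ (by omega)] at hst
    rcases hne0 hst with h1 | h2
    · exact hsmin (m₁ - 1) (by omega) (by omega) (Or.inr ⟨hin₁, hm₁N, hout₁, h1⟩)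
    · have hexit := cyc_block_exit_two D horb hiface hadm hleft (k := m₁ - 1) (n := k + j₀ - m₁)
        (by rw [show m₁ - 1 + (k + j₀ - m₁) + 1 = k + j₀ by omega]; omega) hin₁
        (fun i h1 h2 => by
          by_cases hi : m₁ - 1 + i ≤ k
          · exact hm₁ _ (by omega) hi
          · rw [show m₁ - 1 + i = k + (m₁ - 1 + i - k) by omega]
            exact houtj _ (by omega) (by omega))
        (by omega) (by rw [show m₁ - 1 + (k + j₀ - m₁) + 1 = k + j₀ by omega]; exact hj₀G) h2
      rw [show m₁ - 1 + (k + j₀ - m₁) + 1 = k + j₀ by omega, show m₁ - 1 + (k + j₀ - m₁) = k + j₀ - 1 by omega] at hexit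
      refine hrmax (k + j₀) (by omega) (by omega) (Or.inr ⟨hj₀G, by omega, ?_, hexit⟩)
      show ρ (k + j₀ - 1) ∉ D.verts
      by_cases hj1 : j₀ = 1
      · rw [hj1, Nat.add_sub_cancel]; exact hout
      · rw [show k + j₀ - 1 = k + (j₀ - 1) by omega]; exact houtj _ (by omega) (by omega)
  -- (m2): … and off the path
  have hm2 : ∀ k, r < k → k < s → ρ k ∉ Q := by
    intro k hk1 hk2 hkQ
    rw [hQeq'] at hkQ
    rcases List.mem_append.1 hkQ with h | h
    · exact hsmin k (by omega) hk2 (Or.inl h)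
    · exact hrmax k hk1 (by omega) (Or.inl h)
  rcases Nat.lt_or_ge r s with hrs' | hsr
  · -- the main case
    have hsA : ρ s ∈ L₁ ++ [a] ∨ (ρ s ∉ Q ∧
        ∃ nu', D.pos 1 ≤ nu' ∧ nu' < D.pos 2 ∧ ρ s = (triBdryIter D.verts D.base nu').1 ∧
          YellowTowards σ (triBdryIter D.verts D.base nu')) := by
      by_cases h1 : ρ s ∈ L₁ ++ [a]
      · exact Or.inl h1
      · rcases hA1s with h | ⟨hG, hs1, hout, hst⟩
        · exact absurd h h1
        · have hnQ : ρ s ∉ Q := by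
            rw [hQeq']; intro h
            rcases List.mem_append.1 h with h | h
            · exact h1 h
            · exact hrmax s hrs' hsN (Or.inl h)
          obtain ⟨hd, hp1, hpu, ht, hY⟩ := hc1 s hs1 hG hout hst (hneHead _ h1)
          exact Or.inr ⟨hnQ, _, hp1, by omega, ht.symm, hY⟩
    have hrT : ρ r ∈ b :: L₂ ∨ (ρ r ∉ Q ∧
        ∃ nv', D.pos 2 ≤ nv' ∧ nv' < L ∧ ρ r = (triBdryIter D.verts D.base nv').1 ∧
          YellowTowards σ (triBdryIter D.verts D.base nv')) := by
      by_cases h2 : ρ r ∈ b :: L₂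
      · exact Or.inl h2
      · rcases hA2r with h | ⟨hG, hr1, hout, hst⟩
        · exact absurd h h2
        · have hnQ : ρ r ∉ Q := by
            rw [hQeq']; intro h
            rcases List.mem_append.1 h with h | h
            · exact hsmin r le_rfl hrs' (Or.inl h)
            · exact h2 h
          obtain ⟨hd, hpv, hpL, ht, hY⟩ := hc2 r hr1 (by omega) hG hout hst (hneLast _ h2)
          exact Or.inr ⟨hnQ, _, by omega, hpL, ht.symm, hY⟩
    have hne : ρ r ≠ ρ s := by
      intro heq
      rcases hsA with h1 | ⟨h1, -⟩
      · exact hsmin r le_rfl hrs' (Or.inl (heq ▸ h1))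
      · rcases hrT with h2 | ⟨h2, -⟩
        · exact hrmax s hrs' hsN (Or.inl (heq ▸ h2))
        · rcases hA2r with h | hA2r'
          · exact h2 (by rw [hQeq']; exact List.mem_append_right _ h)
          · rcases hA1s with h | hA1s'
            · exact h1 (by rw [hQeq']; exact List.mem_append_left _ h)
            · exact htwo r s heq h2 ⟨hA2r'.2.1, by omega, hA2r'.1, hA2r'.2.2.1, hA2r'.2.2.2⟩
                ⟨hA1s'.2.1, hA1s'.1, hA1s'.2.2.1, hA1s'.2.2.2⟩
    exact cyc_main_false D horb hiface hadm hleft hretG hbc0 hnotw hQeq hQnd hQch hQG hQB hQY hnu1 hnu2 hnv2 hnvL hQhead hYu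
      hQlast hYv hrs' hsN'
      (fun k h1 h2 => by
        rcases Nat.lt_or_ge r k with hk | hk
        · rcases Nat.lt_or_ge k s with hk' | hk'
          · exact hm1 k hk hk'
          · rw [show k = s by omega]; exact hρsG
        · rw [show k = r by omega]; exact hρrG)
      hm2 hne hsA hrT
  · -- the degenerate cases: `r = s`
    have hrs0 : r = s := le_antisymm hrs hsr
    by_cases h2 : ρ r ∈ b :: L₂ <;> by_cases h1 : ρ s ∈ L₁ ++ [a]
    · exact hdisj _ h1 (hrs0 ▸ h2)
    · rcases hA1s with h | ⟨hG, hs1, hout, hst⟩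
      · exact h1 h
      · obtain ⟨hd, hp1, hpu, ht, hY⟩ := hc1 s hs1 hG hout hst (hneHead _ h1)
        exact false_of_contact_one D hnotw hQeq hQnd hQch hQG hQB hQY hnu1 hnu2 hnv2 hnvL hQhead hQlast hYv hC hπw hw
          (hrs0 ▸ h2) hp1 hpu ht hY
    · rcases hA2r with h | ⟨hG, hr1, hout, hst⟩
      · exact h2 h
      · obtain ⟨hd, hpv, hpL, ht, hY⟩ := hc2 r hr1 (by omega) hG hout hst (hneLast _ h2)
        exact false_of_contact_two D hnotw hQeq hQnd hQch hQG hQB hQY hnu1 hnu2 hnv2 hnvL hQhead hYu hQlast hC hπw hw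
          (hrs0 ▸ h1) hpv hpL ht hY
    · rcases hA2r with h | hA2r'
      · exact h2 h
      · rcases hA1s with h | hA1s'
        · exact h1 h
        · have hnQ : ρ r ∉ Q := by
            rw [hQeq']; intro h
            rcases List.mem_append.1 h with h | h
            · exact h1 (hrs0 ▸ h)
            · exact h2 h
          exact htwo r s (by rw [hrs0]) hnQ ⟨hA2r'.2.1, by omega, hA2r'.1, hA2r'.2.2.1, hA2r'.2.2.2⟩
            ⟨hA1s'.2.1, hA1s'.1, hA1s'.2.2.1, hA1s'.2.2.2⟩

end CycleFalse

end Summit.CriticalPhenomena.CardyFormulaZ2.Theorems.BondTriangularCardyLine.KiteB
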